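import Summits.ResolutionOfSingularities.ResolutionOfSingularities.Theorems.WildConesCampaignW46HypersurfacesCharTwoFreePoints
import Summits.ResolutionOfSingularities.ResolutionOfSingularities.Theorems.WildConesCampaignW46HypersurfacesCharTwoCubicPolarization

/-!
# [OURS · L1 W4.6, rung (ii) at p = 2, EVERY dimension n] THE CUBE CRITERION: in the multiple-tangent
# class `(e, h₂) = (2, 2)` with satellite direction `w₀`, a FREE infinitely-near double point exists IF AND
# ONLY IF `w₀` is NOT a null polar (the kernel cubic is `ℓ₁²ℓ₂` with `ℓ₂ ∤ ℓ₁`, not a cube `ℓ₁³`); so over a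
# perfect field there are EXACTLY TWO near double points or EXACTLY ONE — `z² = a(u₁,…,uₙ)`, char. 2

HONEST FRAMING. Everything here is OURS: theorems about route WildCones' own TYPED point-blow-up dynamics
(`Theorems/WildConesClassicalRegimesDefs.lean`) and the seat's invariants `polarMatrix` (p502936),
`milnorEmbDim` (p498937), `milnorHilbertTwo` (p511581), `degForm` (p522667). NOTHING here is a statement
of the manuscript [Hironaka2017]; no FACT-LIST premise; AI review is weaker than expert review. Cell
res-hironaka (LADDER-RESOLUTION rung L, D-0089), slot W4.6, seat res-L1-s46-pv-4 (gen 6); host route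
`WildCones`, crux `ClassicalRegimes` (stmt-ResolutionOfSingularities-16884; proved).

THE ARGUMENT. At `(2,2)` the kernel plane `K` carries two distinguished lines: the null polars `N`
(p542945: `dim N = 1`) and the satellite line `S = κw₀` (`w₀` the unique singular direction of the kernel
cubic, p536239 / p538084). By cubic polarization (p543928) and the satellite property (`a₃(w₀) = 0`, all
polars vanish AT `w₀`), along any kernel vector `v`: `a₃(w₀ + xv) = x²·(polar(w₀, v) + x·a₃(v))`. Hence:
if `w₀ ∉ N` (some `polar(w₀, v) ≠ 0`) the third root `x₁ = polar(w₀,v)/a₃(v)` (or `[v]` itself when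
`a₃(v) = 0`) is a near point at which the polar of `w₀` is `x₁²·polar(w₀,v) ≠ 0`: a FREE near point
exists; if `w₀ ∈ N` then at any near vector `w ∉ κw₀` all polars vanish (`polar(w₀, w) = 0` by nullity,
`polar(w, w) = a₃(w) = 0` by Euler), making `w` a second satellite — impossible at `h₂ ≤ 2`; so the only
near point is `[w₀]`: NO free point, the kernel cubic is the cube `ℓ₁³`.

WHAT IS PROVED (every `n`, every field of characteristic `2` unless marked):

* `degForm_three_along_satellite` — `a₃(w₀ + xv) = x²·polar(w₀,v) + x³·a₃(v)` for a satellite `w₀`;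
  `polar_satellite_add` — `polar(w₀, w₀ + y) = polar(w₀, y)`; `polar_smul_right`, `polar_zero_right`;
* `hypersurface_exists_free_of_satellite_not_null` — isolated, `e = 2`, satellite `w₀`, a kernel `v` with
  `polar(w₀, v) ≠ 0` ⇒ a double successor of corank `0` (free) EXISTS;
* `hypersurface_only_satellite_of_satellite_null` — `e = 2`, `h₂ ≤ 2`, satellite `w₀ ≠ 0` which is a null
  polar ⇒ EVERY near vector is a multiple of `w₀`, with corank-two successor (one near point);
* `hypersurface_exists_free_iff_satellite_not_null` — isolated `(2,2)` with satellite `w₀ ≠ 0`: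
  **a free near double point exists ⟺ `w₀ ∉ N`**;
* `hypersurface_near_count_exact_of_milnorHilbertTwo_eq_two` — PERFECT field, isolated `(2,2)`: EITHER
  (`S ≠ N`) exactly two near double points — the satellite AND a free point — OR (`S = N`) exactly one,
  the satellite: every near vector is a multiple of `w₀`. With p544683 (`≤ 1` of each kind) the counts
  are exact.

References: [CasasAlvero2000] §3 (free/satellite: context only); [GreuelPfister2026] (context);
[Hironaka2017] Th. 16.6 p.84 — role replaced only, under adjudication; nothing of it is used.
-/

noncomputable section

-- single-problem summit: the doubled namespace component `ResolutionOfSingularities` is forced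
set_option linter.dupNamespace false

open scoped BigOperators Classical

open MvPowerSeries IsLocalRing

open Literature.AlgebraicGeometry.Resolution

namespace Summit.ResolutionOfSingularities.ResolutionOfSingularities.Theorems

namespace CampaignW46.HypersurfacesCharTwo

open WildCones WildCones.MuDropCharTwoOrdP ThreefoldsCharTwo

variable {κ : Type} [Field κ] {n : ℕ}

/-! ## Polars: scaling and the satellite -/

/-- [OURS · L1 W4.6] The polar is quadratic in its second argument: `polar(λ, r·v) = r²·polar(λ, v)`.
[folklore] -/
theorem polar_smul_right (f : MvPowerSeries (Fin n) κ) (lam v : Fin n → κ) (r : κ) :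
    ∑ s, lam s * degForm 2 (MvPowerSeries.pderiv s f) (r • v) =
      r ^ 2 * ∑ s, lam s * degForm 2 (MvPowerSeries.pderiv s f) v := by
  rw [Finset.mul_sum]
  refine Finset.sum_congr rfl fun s _ => ?_
  rw [degForm_smul_vec]
  ring

/-- [OURS · L1 W4.6] `polar(λ, 0) = 0`. [folklore] -/
theorem polar_zero_right (f : MvPowerSeries (Fin n) κ) (lam : Fin n → κ) :
    ∑ s, lam s * degForm 2 (MvPowerSeries.pderiv s f) 0 = 0 :=
  Finset.sum_eq_zero fun s _ => by rw [degForm_zero_vec (by norm_num), mul_zero]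

/-- [OURS · L1 W4.6] **The tangent cubic along a line through a satellite**: if all kernel polars vanish
at the kernel vector `w₀` (characteristic two), then for every kernel `v` and scalar `x`,
`a₃(w₀ + x·v) = x²·polar(w₀, v) + x³·a₃(v)` (`a₃(w₀) = polar(w₀,w₀) = 0`, `polar(v, w₀) = 0`).
[folklore] -/
theorem degForm_three_along_satellite [CharP κ 2] (f : MvPowerSeries (Fin n) κ) {w₀ v : Fin n → κ}
    (hw₀ : Matrix.vecMul w₀ (polarMatrix f) = 0) (hv : Matrix.vecMul v (polarMatrix f) = 0)
    (hsat : ∀ lam : Fin n → κ, Matrix.vecMul lam (polarMatrix f) = 0 →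
      ∑ s, lam s * degForm 2 (MvPowerSeries.pderiv s f) w₀ = 0) (x : κ) :
    degForm 3 f (w₀ + x • v) = x ^ 2 * ∑ s, w₀ s * degForm 2 (MvPowerSeries.pderiv s f) v +
      x ^ 3 * degForm 3 f v := by
  rw [degForm_three_add_smul, degForm_three_eq_polar_self f w₀, hsat w₀ hw₀, hsat v hv, mul_zero, zero_add,
    zero_add]

/-- [OURS · L1 W4.6] The polar of `w₀` at `w₀ + y` when all kernel polars vanish at the kernel vector `w₀`
(characteristic two): `polar(w₀, w₀ + y) = polar(w₀, y)` (quadratic polarization p536239;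
`polar(w₀, w₀) = 0`, cross term `T(w₀; w₀, y) = 0`). [folklore] -/
theorem polar_satellite_add [CharP κ 2] (f : MvPowerSeries (Fin n) κ) {w₀ : Fin n → κ}
    (hw₀ : Matrix.vecMul w₀ (polarMatrix f) = 0)
    (hsat : ∀ lam : Fin n → κ, Matrix.vecMul lam (polarMatrix f) = 0 →
      ∑ s, lam s * degForm 2 (MvPowerSeries.pderiv s f) w₀ = 0) (y : Fin n → κ) :
    ∑ s, w₀ s * degForm 2 (MvPowerSeries.pderiv s f) (w₀ + y) =
      ∑ s, w₀ s * degForm 2 (MvPowerSeries.pderiv s f) y := by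
  rw [← degForm_two_sum_C_mul_pderiv, ← degForm_two_sum_C_mul_pderiv, degForm_two_add,
    degForm_two_sum_C_mul_pderiv f w₀ w₀, hsat w₀ hw₀, zero_add, polarCross_self_eq_zero, add_zero]

/-! ## A free point exists off the null line -/

/-- [OURS · L1 W4.6 rung (ii) at `p = 2`, every dimension; NOT a statement of the manuscript] **IF THE
SATELLITE IS NOT A NULL POLAR, A FREE NEAR DOUBLE POINT EXISTS.** Let `c` be an isolated double state
of `z² = a(u₁,…,uₙ)` (any field of characteristic `2`) with `e(c) = 2`, `w₀` a kernel vector at which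
all kernel polars vanish (a satellite direction), and `v` a kernel vector with `polar(w₀, v) ≠ 0`. Then
some chart and translation give a double successor of CORANK `0` — a free infinitely-near double point
(isolated, `μ = 1`, nothing after it, p533887): at `[v]` if `a₃(v) = 0`, else at
`[w₀ + x₁v]`, `x₁ = polar(w₀,v)/a₃(v)`, the third root of the kernel cubic. [folklore] -/
theorem hypersurface_exists_free_of_satellite_not_null [CharP κ 2] (c : (Fin n → ℕ) → κ)
    (hM : MultP 2 n κ c) (hI : Isol 2 n κ c) (he : milnorEmbDim 2 n κ c = 2) {w₀ v : Fin n → κ}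
    (hw₀ : Matrix.vecMul w₀ (polarMatrix (ser 2 n κ c)) = 0)
    (hsat : ∀ lam : Fin n → κ, Matrix.vecMul lam (polarMatrix (ser 2 n κ c)) = 0 →
      ∑ s, lam s * degForm 2 (MvPowerSeries.pderiv s (ser 2 n κ c)) w₀ = 0)
    (hv : Matrix.vecMul v (polarMatrix (ser 2 n κ c)) = 0)
    (hp : ∑ s, w₀ s * degForm 2 (MvPowerSeries.pderiv s (ser 2 n κ c)) v ≠ 0) :
    ∃ (i : Fin n) (τ : Fin n → κ), MultP 2 n κ (step 2 n κ i τ c) ∧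
      milnorEmbDim 2 n κ (step 2 n κ i τ c) = 0 := by
  set f := ser 2 n κ c with hfdef
  set p := ∑ s, w₀ s * degForm 2 (MvPowerSeries.pderiv s f) v with hpdef
  -- the free near vector `w₁`: kernel, on the cubic, with `polar(w₀, w₁) ≠ 0`
  obtain ⟨w₁, hk₁, hc₁, hp₁⟩ : ∃ w₁ : Fin n → κ, Matrix.vecMul w₁ (polarMatrix f) = 0 ∧
      degForm 3 f w₁ = 0 ∧ ∑ s, w₀ s * degForm 2 (MvPowerSeries.pderiv s f) w₁ ≠ 0 := by
    by_cases ha : degForm 3 f v = 0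
    · exact ⟨v, hv, ha, hp⟩
    · set x₁ := p / degForm 3 f v with hx₁
      have hx : x₁ * degForm 3 f v = p := div_mul_cancel₀ p ha
      have hx0 : x₁ ≠ 0 := div_ne_zero hp ha
      refine ⟨w₀ + x₁ • v, ?_, ?_, ?_⟩
      · rw [Matrix.add_vecMul, Matrix.smul_vecMul, hw₀, hv, smul_zero, add_zero]
      · rw [degForm_three_along_satellite f hw₀ hv hsat]
        calc x₁ ^ 2 * p + x₁ ^ 3 * degForm 3 f v = x₁ ^ 2 * (p + x₁ * degForm 3 f v) := by ring
          _ = 0 := by rw [hx, CharTwo.add_self_eq_zero, mul_zero]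
      · rw [polar_satellite_add f hw₀ hsat, polar_smul_right]
        exact mul_ne_zero (pow_ne_zero 2 hx0) hp
  -- it is non-zero; visit it in the chart of a non-zero coordinate
  have hw₁0 : w₁ ≠ 0 := by
    intro h0
    rw [h0, polar_zero_right] at hp₁
    exact hp₁ rfl
  obtain ⟨i, hi⟩ : ∃ i, w₁ i ≠ 0 := by
    by_contra h
    push Not at h
    exact hw₁0 (funext h)
  have hM' := hypersurface_multP_step_of_vec c hM hI hi hk₁ hc₁
  refine ⟨i, _, hM', (hypersurface_milnorEmbDim_step_eq_zero_iff c i _ hM he hM').mpr ⟨w₀, hw₀, ?_⟩⟩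
  rw [update_inv_smul_eq hi, polar_smul_right]
  exact mul_ne_zero (pow_ne_zero 2 (inv_ne_zero hi)) hp₁

/-! ## On the null line there is only the satellite -/

/-- [OURS · L1 W4.6 rung (ii) at `p = 2`, every dimension; NOT a statement of the manuscript] **IF THE
SATELLITE IS A NULL POLAR, IT IS THE ONLY NEAR DOUBLE POINT.** Let `c` be a double state of
`z² = a(u₁,…,uₙ)` (any field of characteristic `2`) with `e(c) = 2`, `h₂(c) ≤ 2`, and `w₀ ≠ 0` a kernel
vector at which all kernel polars vanish AND whose own polar vanishes on the kernel (`S = N`: the kernel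
cubic is a cube `ℓ₁³`). Then the near vector of EVERY double successor is a multiple of `w₀`, and the
successor has corank `2`: a near vector `w ∉ κw₀` would be a second satellite (`polar(w₀, w) = 0`,
`polar(w, w) = a₃(w) = 0`), contradicting p536239. [folklore] -/
theorem hypersurface_only_satellite_of_satellite_null [CharP κ 2] (c : (Fin n → ℕ) → κ)
    (hM : MultP 2 n κ c) (he : milnorEmbDim 2 n κ c = 2) (hh : milnorHilbertTwo 2 n κ c ≤ 2)
    {w₀ : Fin n → κ} (hw₀0 : w₀ ≠ 0) (hw₀ : Matrix.vecMul w₀ (polarMatrix (ser 2 n κ c)) = 0)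
    (hsat : ∀ lam : Fin n → κ, Matrix.vecMul lam (polarMatrix (ser 2 n κ c)) = 0 →
      ∑ s, lam s * degForm 2 (MvPowerSeries.pderiv s (ser 2 n κ c)) w₀ = 0)
    (hnull : ∀ v : Fin n → κ, Matrix.vecMul v (polarMatrix (ser 2 n κ c)) = 0 →
      ∑ s, w₀ s * degForm 2 (MvPowerSeries.pderiv s (ser 2 n κ c)) v = 0)
    (i : Fin n) (τ : Fin n → κ) (hM' : MultP 2 n κ (step 2 n κ i τ c)) :
    (∃ r : κ, Function.update τ i 1 = r • w₀) ∧ milnorEmbDim 2 n κ (step 2 n κ i τ c) = 2 := by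
  set f := ser 2 n κ c with hfdef
  obtain ⟨hk, hc⟩ := hypersurface_ker_and_cubic_of_double_successor c i τ hM hM'
  set w := Function.update τ i 1 with hwdef
  -- all kernel polars vanish at `w`
  have hsw : ∀ lam : Fin n → κ, Matrix.vecMul lam (polarMatrix f) = 0 →
      ∑ s, lam s * degForm 2 (MvPowerSeries.pderiv s f) w = 0 := by
    intro lam hlam
    by_cases hprop : ∃ r : κ, w = r • w₀
    · obtain ⟨r, hr⟩ := hprop
      rw [hr, polar_smul_right, hsat lam hlam, mul_zero]
    · push Not at hprop
      obtain ⟨α, β, hαβ⟩ := kernel_span_pair hM he hw₀0 hw₀ hk hprop lam hlam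
      rw [← hαβ, polar_add_smul, hnull w hk, ← degForm_three_eq_polar_self, hc, mul_zero, mul_zero, add_zero]
  exact ⟨hypersurface_satellite_unique c hM he hh hw₀0 hw₀ hk hsat hsw,
    (hypersurface_milnorEmbDim_step_eq_two_iff c i τ hM he hM').mpr hsw⟩

/-! ## The criterion and the exact count -/

/-- [OURS · L1 W4.6 rung (ii) at `p = 2`, every dimension; NOT a statement of the manuscript] **THE CUBE
CRITERION**: for an isolated double state with `(e, h₂) = (2, 2)` over any field of characteristic `2`
and a satellite direction `w₀ ≠ 0` (kernel vector at which all kernel polars vanish): a FREE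
infinitely-near double point (a double successor of corank `0`) EXISTS if and only if `w₀` is NOT a null
polar (some `polar(w₀, v) ≠ 0`, `v ∈ ker P`) — the satellite line differs from the null-polar line, the
kernel cubic is `ℓ₁²ℓ₂` rather than `ℓ₁³`. [folklore] -/
theorem hypersurface_exists_free_iff_satellite_not_null [CharP κ 2] (c : (Fin n → ℕ) → κ)
    (hM : MultP 2 n κ c) (hI : Isol 2 n κ c) (he : milnorEmbDim 2 n κ c = 2)
    (hh : milnorHilbertTwo 2 n κ c = 2) {w₀ : Fin n → κ} (hw₀0 : w₀ ≠ 0)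
    (hw₀ : Matrix.vecMul w₀ (polarMatrix (ser 2 n κ c)) = 0)
    (hsat : ∀ lam : Fin n → κ, Matrix.vecMul lam (polarMatrix (ser 2 n κ c)) = 0 →
      ∑ s, lam s * degForm 2 (MvPowerSeries.pderiv s (ser 2 n κ c)) w₀ = 0) :
    (∃ (i : Fin n) (τ : Fin n → κ), MultP 2 n κ (step 2 n κ i τ c) ∧
        milnorEmbDim 2 n κ (step 2 n κ i τ c) = 0) ↔
      ∃ v : Fin n → κ, Matrix.vecMul v (polarMatrix (ser 2 n κ c)) = 0 ∧
        ∑ s, w₀ s * degForm 2 (MvPowerSeries.pderiv s (ser 2 n κ c)) v ≠ 0 := by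
  constructor
  · rintro ⟨i, τ, hM', he'⟩
    by_contra h
    push Not at h
    have h2 := (hypersurface_only_satellite_of_satellite_null c hM he (by omega) hw₀0 hw₀ hsat h i τ hM').2
    omega
  · rintro ⟨v, hv, hp⟩
    exact hypersurface_exists_free_of_satellite_not_null c hM hI he hw₀ hsat hv hp

/-- [OURS · L1 W4.6 rung (ii) at `p = 2`, every dimension, PERFECT field; NOT a statement of the
manuscript] **THE EXACT COUNT AT `(2,2)`**: an isolated double state of `z² = a(u₁,…,uₙ)` over a perfect
field of characteristic `2` with `e(c) = 2`, `h₂(c) = 2` has a satellite direction `w₀ ≠ 0` (p538084),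
and EITHER (`w₀ ∉ N`) there are a corank-two double successor AND a corank-zero double successor — with
p544683 (at most one of each) EXACTLY TWO infinitely-near double points, the satellite and a free point —
OR (`w₀ ∈ N`, the cube case) EVERY double successor sits at `[w₀]` with corank two — EXACTLY ONE
infinitely-near double point. [folklore] -/
theorem hypersurface_near_count_exact_of_milnorHilbertTwo_eq_two [CharP κ 2] [PerfectField κ]
    (c : (Fin n → ℕ) → κ) (hM : MultP 2 n κ c) (hI : Isol 2 n κ c) (he : milnorEmbDim 2 n κ c = 2)
    (hh : milnorHilbertTwo 2 n κ c = 2) :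
    ∃ w₀ : Fin n → κ, w₀ ≠ 0 ∧ Matrix.vecMul w₀ (polarMatrix (ser 2 n κ c)) = 0 ∧
      (∀ lam : Fin n → κ, Matrix.vecMul lam (polarMatrix (ser 2 n κ c)) = 0 →
        ∑ s, lam s * degForm 2 (MvPowerSeries.pderiv s (ser 2 n κ c)) w₀ = 0) ∧
      (((∃ v : Fin n → κ, Matrix.vecMul v (polarMatrix (ser 2 n κ c)) = 0 ∧
            ∑ s, w₀ s * degForm 2 (MvPowerSeries.pderiv s (ser 2 n κ c)) v ≠ 0) ∧
          (∃ (i : Fin n) (τ : Fin n → κ), MultP 2 n κ (step 2 n κ i τ c) ∧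
            milnorEmbDim 2 n κ (step 2 n κ i τ c) = 2) ∧
          ∃ (i : Fin n) (τ : Fin n → κ), MultP 2 n κ (step 2 n κ i τ c) ∧
            milnorEmbDim 2 n κ (step 2 n κ i τ c) = 0) ∨
        ((∀ v : Fin n → κ, Matrix.vecMul v (polarMatrix (ser 2 n κ c)) = 0 →
            ∑ s, w₀ s * degForm 2 (MvPowerSeries.pderiv s (ser 2 n κ c)) v = 0) ∧
          ∀ (i : Fin n) (τ : Fin n → κ), MultP 2 n κ (step 2 n κ i τ c) →
            (∃ r : κ, Function.update τ i 1 = r • w₀) ∧ milnorEmbDim 2 n κ (step 2 n κ i τ c) = 2)) := by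
  obtain ⟨w₀, hw₀0, hw₀, hsat⟩ := hypersurface_exists_satellite_of_milnorHilbertTwo_eq_two c hM he hh
  refine ⟨w₀, hw₀0, hw₀, hsat, ?_⟩
  by_cases hN : ∃ v : Fin n → κ, Matrix.vecMul v (polarMatrix (ser 2 n κ c)) = 0 ∧
      ∑ s, w₀ s * degForm 2 (MvPowerSeries.pderiv s (ser 2 n κ c)) v ≠ 0
  · refine Or.inl ⟨hN, ?_, (hypersurface_exists_free_iff_satellite_not_null c hM hI he hh hw₀0 hw₀ hsat).mpr hN⟩
    obtain ⟨i, hi⟩ : ∃ i, w₀ i ≠ 0 := by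
      by_contra h
      push Not at h
      exact hw₀0 (funext h)
    exact ⟨i, _, hypersurface_singular_direction_corank_two c hM hI he hi hw₀ hsat⟩
  · push Not at hN
    exact Or.inr ⟨hN, fun i τ hM' =>
      hypersurface_only_satellite_of_satellite_null c hM he (by omega) hw₀0 hw₀ hsat hN i τ hM'⟩

end CampaignW46.HypersurfacesCharTwo

end Summit.ResolutionOfSingularities.ResolutionOfSingularities.Theorems

end
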